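import Summits.Langlands.Langlands.Theses.SeedParityLadder

/-!
# Route SeedParityLadder — Assembly

The assembly item (stmt-Langlands-27038) of the child route `SeedParityLadder` (decomp-langlands lens-1 gen 19; a gate-native D-0170
refining child: `--refines route-Langlands-QuarterConductorLadder:OffQuarterBoxAvatars`, edge split, depth 1, no FRAME item) for the
declared-residual belt crux QO = `QuarterConductorLadder.OffQuarterBoxAvatars` (stmt-Langlands-26826):
`HolomorphicSeedAvatars → MaassTypeSeedAvatars → SeedlessBeltAvatars → QuarterConductorLadder.OffQuarterBoxAvatars`.

This is literally the type of the route file's sorry-free deciding theorem `Summit.Langlands.Langlands.Theses.SeedParityLadder.closes`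
(two excluded middles on the nested dials: holomorphic seed presentation / some totally-real non-regular seed presentation / none).
Nothing here proves `Langlands` (nor QO): the assembly records only that the three ledger items of the route, taken together, imply
the refined crux.
-/

set_option linter.dupNamespace false -- project-wide option (lakefile weak.linter.dupNamespace); `Summit.Langlands.Langlands` is the mandated namespace

namespace Summit.Langlands.Langlands.Theorems

/-- **Assembly of route SeedParityLadder** (stmt-Langlands-27038): `HOL → MIX → REST → QuarterConductorLadder.OffQuarterBoxAvatars`.
Proof: unfold `Assembly` and apply the route's deciding theorem `Theses.SeedParityLadder.closes`. -/
theorem seedParityLadder_assembly_proof :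
    Summit.Langlands.Langlands.Theses.SeedParityLadder.Assembly := by
  unfold Summit.Langlands.Langlands.Theses.SeedParityLadder.Assembly
  exact Summit.Langlands.Langlands.Theses.SeedParityLadder.closes

end Summit.Langlands.Langlands.Theorems
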